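import Summits.Ventures.CertifiedManyBodySolver.Certificates.S1Rm2uTierP.Head
import Summits.Ventures.CertifiedManyBodySolver.Certificates.S1Rm2uTierP.Hints002
import Summits.Ventures.CertifiedManyBodySolver.Rows.CorrWindowCertKernelChainQuotAdjFastBox

/-!
# tier-P instance (S1Rm2u-R13-W3) — chain forest segment 7 of 103 (steps 24..27 from `[]`), file 1 of 1: steps 24..27 (topology (B): eval%-chained accumulators, import-serial INSIDE the segment only)

Generated by hubbard-algo-p2's untrusted exporter (emit_v0.py + emit_w3.py); every datum below is re-derived / re-checked by the kernel chain
(`stepEQA`, Rows/CorrWindowCertKernelChainQuotAdj.lean) or is inert. HONEST FRAMING (xx1): instance data / kernel replay of a CONTROL/CALIBRATION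
certificate (S1′-Rm2-u″ INNER pinned spoke of the La214-E t′-pair {hub′ −3/10, S1′ −1/5}: t′ = −1/5, OWN f-sum objective, eom multipliers PINNED to the hub-Rm2-u′ certificate (EB by name), sdp-1 (R1) C-edition j326976, 4^40-dyadic two-level Gram factors); nothing here is a theorem about the Hubbard model; no summit statement. [cite: Han2020Bootstrap, §3]
-/

set_option linter.style.longLine false
set_option maxRecDepth 100000
set_option maxHeartbeats 0

namespace Summit.Ventures.CertifiedManyBodySolver
namespace CARPolyWindow.TierP.S1Rm2u
open Summit.Ventures.CertifiedQuantumChemistry Summit.Ventures.CertifiedQuantumChemistry.CARPoly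
open Literature.MathematicalPhysics.QuantumLattice Literature.MathematicalPhysics.QuantumLattice.HubbardWave0
open Literature.Probability.LatticeModels
open CARPolyWindow CARPolyWindow.BoxGeom

/-- segment 7 starts from the EMPTY accumulator before step 24 (chain forest, R-g4-11 (L6)). [folklore] -/
def C7_0 : SOSDual.EncPoly := []

/-- accumulator after step 25 within segment 7 (evaluated at elaboration; the kernel re-derives it in `step_24`). [folklore] -/
def C7_1 : SOSDual.EncPoly := eval% stepEQA D 2048 C7_0 (slices.getD 24 []) (hintsOfCodes Dr reps HC24)

/-- KERNEL FACT, step 24 of 350 (fast step (L7): `stepEQAFB_kernel`, box edition). [folklore] -/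
theorem step_24 : C7_1 = stepEQA D 2048 C7_0 (slices.getD 24 []) (hintsOfCodes Dr reps HC24) :=
  stepEQAFB_kernel 6 13 7 rfl (by decide +kernel)

/-- accumulator after step 26 within segment 7 (evaluated at elaboration; the kernel re-derives it in `step_25`). [folklore] -/
def C7_2 : SOSDual.EncPoly := eval% stepEQA D 2048 C7_1 (slices.getD 25 []) (hintsOfCodes Dr reps HC25)

/-- KERNEL FACT, step 25 of 350 (fast step (L7): `stepEQAFB_kernel`, box edition). [folklore] -/
theorem step_25 : C7_2 = stepEQA D 2048 C7_1 (slices.getD 25 []) (hintsOfCodes Dr reps HC25) :=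
  stepEQAFB_kernel 6 13 7 rfl (by decide +kernel)

/-- accumulator after step 27 within segment 7 (evaluated at elaboration; the kernel re-derives it in `step_26`). [folklore] -/
def C7_3 : SOSDual.EncPoly := eval% stepEQA D 2048 C7_2 (slices.getD 26 []) (hintsOfCodes Dr reps HC26)

/-- KERNEL FACT, step 26 of 350 (fast step (L7): `stepEQAFB_kernel`, box edition). [folklore] -/
theorem step_26 : C7_3 = stepEQA D 2048 C7_2 (slices.getD 26 []) (hintsOfCodes Dr reps HC26) :=
  stepEQAFB_kernel 6 13 7 rfl (by decide +kernel)

/-- accumulator after step 28 within segment 7 (evaluated at elaboration; the kernel re-derives it in `step_27`). [folklore] -/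
def C7_4 : SOSDual.EncPoly := eval% stepEQA D 2048 C7_3 (slices.getD 27 []) (hintsOfCodes Dr reps HC27)

/-- KERNEL FACT, step 27 of 350 (fast step (L7): `stepEQAFB_kernel`, box edition). [folklore] -/
theorem step_27 : C7_4 = stepEQA D 2048 C7_3 (slices.getD 27 []) (hintsOfCodes Dr reps HC27) :=
  stepEQAFB_kernel 6 13 7 rfl (by decide +kernel)


end CARPolyWindow.TierP.S1Rm2u
end Summit.Ventures.CertifiedManyBodySolver
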